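import Summits.ResolutionOfSingularities.ResolutionOfSingularities.Theorems.FrobeniusClosingSteerGeoDictQuadratic
import Summits.ResolutionOfSingularities.ResolutionOfSingularities.Theorems.FrobeniusClosingSteerSteeredExit
import Literature.AlgebraicGeometry.Resolution.RegularLocalRingsProofs
import Literature.AlgebraicGeometry.Resolution.ExcellentRingsEssFiniteType
import Literature.AlgebraicGeometry.Resolution.ExcellentRingsFieldProofs
import Mathlib.RingTheory.Ideal.Height
import HarnessLib

/-!
# Crux `Steer` (stmt-ResolutionOfSingularities-16345), chain W4.1, R2 σ_top line, piece G `GeoDict` — the short rows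
# G2 / G3 / G4 / G8 of the G table of record, and the existence of the chain rings (Theses-free)

OURS (campaign `res-hironaka`, rung L ★L-G4, slot W4.1, chain W4.1, seat `res-L0-w41-stub-7` = `res-D-pv-011`, holder of G per
res-L0-w41-plan-1 RULINGS 05:29:17Z (1); replaces the role of no printed item; NOT a statement of the manuscript under review; AI
review is weaker than expert review). The G table of record is res-L0-w41-stub-8's scoping memo `D/res-D-pv-012/G-GeoDict-SCOPING.md`
(5057b7e099caf6bf; rows G0–G10); G0/G5/G6 are `FrobeniusClosingSteerGeoDictQuadratic.lean` (p501788), over the DEF-FREE interface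

  `hT : ∀ z : K, z ∈ T ↔ ∃ a b : R, b ∉ P ∧ z = a / b`        («`T` is `R_P` inside `K`»).

This file proves, over the same interface:

* `GeoDict.exists_locChar` — such a `T` EXISTS for every prime `P` of a subring `R` of a field (the Subring literal; no definition);
* `GeoDict.isRegularLocalRing_of_locChar` (G2) — `R` regular local ⇒ `R_P` regular (Serre's localisation theorem, tree
  `isRegularLocalRing_localization_atPrime`, Matsumura Thm. 19.3, transported by `IsLocalization.algEquiv`);
* `GeoDict.ringKrullDim_of_locChar` (G4) — `dim R_P = height P` (Mathlib `IsLocalization.AtPrime.ringKrullDim_eq_height`);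
* `GeoDict.map_le_maximalIdeal_of_locChar`, `mem_maximalIdeal_pow_of_locChar` (G8) — `P·R_P ⊆ 𝔪_{R_P}`, hence the permissible
  centre's cleaner `f − g^p ∈ P^p` gives `f − g^p ∈ 𝔪_{R_P}^p`;
* `GeoDict.exists_mem_mul_of_isExcParamAlong` — along the local blowing up of `R` along `P`, every exceptional parameter `x` of the
  strict-transform step (an element of `P` of maximal `O`-value) divides `P` in `R₁` (`u₀/x` is a unit of `R₁`) — the input of G6;
* `GeoDict.isExcellentRing_of_locChar` (G3) — if `R = (A₁)_{𝔪_O ∩ A₁}` for a finitely generated `k`-subalgebra `A₁` of `K`, then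
  `R_P` is a localisation of `A₁` at a prime, hence EXCELLENT (tree `isExcellentRing_of_finiteType_field` = Stacks 07QW and
  `IsExcellentRing.of_isLocalization` = Stacks 07QU, both PROVED in the tree — no named fact).
[cite: Matsumura1987, Thm. 19.3] [cite: StacksProject, Tag 07QU] [cite: Cutkosky2014, §2.1] [folklore]
-/

noncomputable section

-- `Summit.<S>.<S>.…` duplicates the summit name by design (single-problem summit).
set_option linter.dupNamespace false

open IsLocalRing

namespace Summit.ResolutionOfSingularities.ResolutionOfSingularities.Theorems.SwitchingDichotomy

open Literature.AlgebraicGeometry.Resolution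

namespace GeoDict

universe u

variable {K : Type u} [Field K]

/-! ## Existence of `R_P` inside `K` (the Subring literal) -/

/-- **`R_P ⊆ K` exists**: for a prime `P` of a subring `R` of a field, the fractions `a / b` (`a ∈ R`, `b ∈ R ∖ P`) form a subring.
[folklore] -/
theorem exists_locChar (R : Subring K) (P : Ideal R) [hP : P.IsPrime] :
    ∃ T : Subring K, ∀ z : K, z ∈ T ↔ ∃ a b : R, b ∉ P ∧ z = (a : K) / b := by
  have h1 : (1 : R) ∉ P := fun h => hP.ne_top (P.eq_top_of_isUnit_mem h isUnit_one)
  refine ⟨{ carrier := {z | ∃ a b : R, b ∉ P ∧ z = (a : K) / b}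
            mul_mem' := ?_, one_mem' := ⟨1, 1, h1, by simp⟩, add_mem' := ?_, zero_mem' := ⟨0, 1, h1, by simp⟩,
            neg_mem' := ?_ }, fun z => Iff.rfl⟩
  · rintro _ _ ⟨a₁, b₁, hb₁, rfl⟩ ⟨a₂, b₂, hb₂, rfl⟩
    refine ⟨a₁ * a₂, b₁ * b₂, fun h => (hP.mem_or_mem h).elim hb₁ hb₂, ?_⟩
    rw [Subring.coe_mul, Subring.coe_mul, div_mul_div_comm]
  · rintro _ _ ⟨a₁, b₁, hb₁, rfl⟩ ⟨a₂, b₂, hb₂, rfl⟩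
    refine ⟨a₁ * b₂ + a₂ * b₁, b₁ * b₂, fun h => (hP.mem_or_mem h).elim hb₁ hb₂, ?_⟩
    have h₁ : (b₁ : K) ≠ 0 := coe_ne_zero_of_not_mem hb₁
    have h₂ : (b₂ : K) ≠ 0 := coe_ne_zero_of_not_mem hb₂
    rw [Subring.coe_mul, Subring.coe_add, Subring.coe_mul, Subring.coe_mul, div_add_div _ _ h₁ h₂]
    ring
  · rintro _ ⟨a, b, hb, rfl⟩
    exact ⟨-a, b, hb, by rw [Subring.coe_neg, neg_div]⟩

/-! ## G2, G4, G8 over the interface -/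

section Shorts

variable {R : Subring K} {P : Ideal R} [hP : P.IsPrime] {T : Subring K}
  (hT : ∀ z : K, z ∈ T ↔ ∃ a b : R, b ∉ P ∧ z = (a : K) / b)
include hT

/-- **G2 — `R_P` is regular when `R` is** (Serre's localisation theorem, Matsumura Thm. 19.3, tree
`isRegularLocalRing_localization_atPrime`). [cite: Matsumura1987, Thm. 19.3] -/
theorem isRegularLocalRing_of_locChar [IsRegularLocalRing R] : IsRegularLocalRing T := by
  letI : Algebra R T := (Subring.inclusion (le_of_locChar hT)).toAlgebra
  haveI : IsLocalization.AtPrime T P := isLocalization_of_locChar hT fun r => rfl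
  haveI := isRegularLocalRing_localization_atPrime R P
  exact IsRegularLocalRing.of_ringEquiv
    (IsLocalization.algEquiv P.primeCompl (Localization.AtPrime P) T).toRingEquiv

/-- **G4 — `dim R_P = height P`.** [folklore] -/
theorem ringKrullDim_of_locChar : ringKrullDim T = P.height := by
  letI : Algebra R T := (Subring.inclusion (le_of_locChar hT)).toAlgebra
  haveI : IsLocalization.AtPrime T P := isLocalization_of_locChar hT fun r => rfl
  exact IsLocalization.AtPrime.ringKrullDim_eq_height P T

/-- **`P·R_P ⊆ 𝔪_{R_P}`.** [folklore] -/
theorem map_le_maximalIdeal_of_locChar [IsLocalRing T] :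
    P.map (Subring.inclusion (le_of_locChar hT)) ≤ maximalIdeal T := by
  refine Ideal.map_le_iff_le_comap.mpr fun a ha => ?_
  rw [Ideal.mem_comap, mem_maximalIdeal_iff_of_locChar hT]
  exact ⟨a, 1, ha, fun h => hP.ne_top (P.eq_top_of_isUnit_mem h isUnit_one), by simp⟩

/-- **G8 — the permissible centre's cleaner**: `f − g^p ∈ P^p` in `R` gives `f − g^p ∈ 𝔪_{R_P}^p` in `R_P` (for the images
under `R ⊆ R_P`). [folklore] -/
theorem mem_maximalIdeal_pow_of_locChar [IsLocalRing T] {y : R} {n : ℕ} (hy : y ∈ P ^ n) :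
    (⟨(y : K), le_of_locChar hT y.2⟩ : T) ∈ maximalIdeal T ^ n := by
  have h : Subring.inclusion (le_of_locChar hT) y ∈ (P ^ n).map (Subring.inclusion (le_of_locChar hT)) :=
    Ideal.mem_map_of_mem _ hy
  rw [Ideal.map_pow] at h
  exact Ideal.pow_right_mono (map_le_maximalIdeal_of_locChar hT) n h

end Shorts

/-! ## The exceptional parameter of the strict-transform step divides the centre in the blown-up ring -/

section ExcParam

variable {O : ValuationSubring K} {R R₁ : Subring K} {P : Ideal R}

/-- **`P ⊆ x·R₁` for an exceptional parameter `x`** of the local blowing up `R₁` of `R` along `P`: `x ∈ P` has maximal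
`O`-value on `P` (`IsExcParamAlong`), so `x = w·u₀` with `w` a unit of `R₁` (value `0`), and `P·R₁ = u₀·R₁ = x·R₁`.
[cite: NovacoskiSpivakovsky2014, Def. 2.11] [folklore] -/
theorem exists_mem_mul_of_isExcParamAlong (hbl : IsLocalBlowupAlong O R P R₁) {x : K}
    (hxP : ∃ hx : x ∈ R, (⟨x, hx⟩ : R) ∈ P) (hx0 : x ≠ 0)
    (hmax : ∀ y : R, y ∈ P → O.valuation (y : K) ≤ O.valuation x) :
    ∀ a : R, a ∈ P → ∃ r ∈ R₁, (a : K) = r * x := by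
  obtain ⟨u₀, hu₀P, hdiv⟩ := hbl.exists_span_singleton
  have hR₁O : R₁ ≤ O.toSubring := hbl.isLocalBlowup.target_le
  obtain ⟨-, u, u₀', -, -, -, -, hR₁⟩ := hbl
  obtain ⟨hx, hxP⟩ := hxP
  obtain ⟨w, hw, hxw⟩ := hdiv ⟨x, hx⟩ hxP
  change x = w * u₀ at hxw
  have hu₀0 : ((u₀ : R) : K) ≠ 0 := by
    intro e
    apply hx0
    rw [hxw, e, mul_zero]
  -- `w` has value `0`: `v(u₀) ≤ v(x) = v(w) v(u₀) ≤ v(u₀)`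
  have hvw1 : O.valuation w ≤ 1 := (O.valuation_le_one_iff w).mpr (hR₁O hw)
  have hvw : O.valuation w = 1 := by
    have h1 : O.valuation ((u₀ : R) : K) ≤ O.valuation x := hmax u₀ hu₀P
    rw [hxw, map_mul] at h1
    have hv0 : O.valuation ((u₀ : R) : K) ≠ 0 := by simpa using hu₀0
    have hv0' : 0 < O.valuation ((u₀ : R) : K) := pos_iff_ne_zero.mpr hv0
    have h2 : 1 ≤ O.valuation w := by
      by_contra hlt
      rw [not_le] at hlt
      have := mul_lt_mul_of_pos_right hlt hv0'
      rw [one_mul] at this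
      exact absurd h1 (not_le.mpr this)
    exact le_antisymm hvw1 h2
  have hwinv : w⁻¹ ∈ R₁ := by
    rw [hR₁] at hw ⊢
    exact inv_mem_locAtCentre hw hvw
  have hw0 : w ≠ 0 := ne_zero_of_valuation_eq_one hvw
  intro a ha
  obtain ⟨y, hy, hay⟩ := hdiv a ha
  refine ⟨y * w⁻¹, R₁.mul_mem hy hwinv, ?_⟩
  rw [hay, hxw]
  field_simp

end ExcParam

/-! ## G3 — excellence: `R_P` is a localisation of the finitely generated model -/

section Excellence

variable {k : Type u} [Field k] [Algebra k K]

/-- **G3 — `R_P` is excellent** when `R = (A₁)_{𝔪_O ∩ A₁}` for a finitely generated `k`-subalgebra `A₁ ⊆ O` of `K`: then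
`R_P = (A₁)_{P ∩ A₁}` inside `K`, a localisation of an algebra of finite type over a field (Stacks 07QW + 07QU, both theorems
of the tree: `isExcellentRing_of_finiteType_field`, `IsExcellentRing.of_isLocalization`). [cite: StacksProject, Tag 07QU]
[cite: Matsumura1987, §32 p. 260] -/
theorem isExcellentRing_of_locChar (O : ValuationSubring K) (A₁ : Subalgebra k K)
    (hfg : A₁.FG) {R : Subring K} (hR : locAtCentre A₁.toSubring O = R)
    {P : Ideal R} [hP : P.IsPrime] {T : Subring K} (hT : ∀ z : K, z ∈ T ↔ ∃ a b : R, b ∉ P ∧ z = (a : K) / b) :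
    IsExcellentRing T := by
  have hA₁R : A₁.toSubring ≤ R := hR ▸ le_locAtCentre A₁.toSubring O
  have hRfrac : ∀ r ∈ R, ∃ a ∈ A₁, ∃ c ∈ A₁, O.valuation c = 1 ∧ r = a / c := fun r hr => by
    rw [← hR] at hr
    exact mem_locAtCentre_iff.mp hr
  -- value-`0` elements of `A₁` are units of `R`, hence outside `P`
  have hunit : ∀ c : K, c ∈ A₁ → O.valuation c = 1 → ∃ hc : c ∈ R, (⟨c, hc⟩ : R) ∉ P := by
    intro c hc hvc
    have hcR : c ∈ R := hA₁R hc
    have hcinv : c⁻¹ ∈ R := by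
      rw [← hR]
      exact inv_mem_locAtCentre (le_locAtCentre A₁.toSubring O hc) hvc
    refine ⟨hcR, fun hmem => hP.ne_top (Ideal.eq_top_of_isUnit_mem _ hmem ?_)⟩
    exact (isUnit_subring_iff_inv_mem _).mpr ⟨ne_zero_of_valuation_eq_one hvc, hcinv⟩
  -- the prime `Q = P ∩ A₁` and the characterisation of `T` as `(A₁)_Q`
  set Q : Ideal A₁.toSubring := P.comap (Subring.inclusion hA₁R) with hQ
  have hT' : ∀ z : K, z ∈ T ↔ ∃ a b : A₁.toSubring, b ∉ Q ∧ z = (a : K) / b := by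
    intro z
    constructor
    · intro hz
      obtain ⟨a, b, hb, rfl⟩ := (hT z).mp hz
      obtain ⟨a₁, ha₁, c₁, hc₁, hvc₁, hac⟩ := hRfrac a a.2
      obtain ⟨b₁, hb₁, d₁, hd₁, hvd₁, hbd⟩ := hRfrac b b.2
      obtain ⟨hc₁R, hc₁P⟩ := hunit c₁ hc₁ hvc₁
      obtain ⟨hd₁R, hd₁P⟩ := hunit d₁ hd₁ hvd₁
      have hc₁0 := ne_zero_of_valuation_eq_one hvc₁
      have hd₁0 := ne_zero_of_valuation_eq_one hvd₁
      have hb0 : (b : K) ≠ 0 := coe_ne_zero_of_not_mem hb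
      have hb₁R : b₁ ∈ R := hA₁R hb₁
      have hb₁P : (⟨b₁, hb₁R⟩ : R) ∉ P := by
        intro hmem
        have : b * ⟨d₁, hd₁R⟩ = ⟨b₁, hb₁R⟩ := by
          apply Subtype.ext
          show (b : K) * d₁ = b₁
          rw [hbd, div_mul_cancel₀ _ hd₁0]
        rcases hP.mem_or_mem (this ▸ hmem : b * ⟨d₁, hd₁R⟩ ∈ P) with h | h
        · exact hb h
        · exact hd₁P h
      refine ⟨⟨a₁ * d₁, A₁.mul_mem ha₁ hd₁⟩, ⟨c₁ * b₁, A₁.mul_mem hc₁ hb₁⟩, ?_, ?_⟩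
      · intro hmem
        rw [hQ, Ideal.mem_comap] at hmem
        have : (⟨c₁, hc₁R⟩ : R) * ⟨b₁, hb₁R⟩ ∈ P := hmem
        rcases hP.mem_or_mem this with h | h
        · exact hc₁P h
        · exact hb₁P h
      · show (a : K) / b = (a₁ * d₁) / (c₁ * b₁)
        rw [hac, hbd]
        field_simp
    · rintro ⟨a, b, hb, rfl⟩
      refine (hT _).mpr ⟨⟨a, hA₁R a.2⟩, ⟨b, hA₁R b.2⟩, fun hmem => hb ?_, rfl⟩
      rw [hQ, Ideal.mem_comap]
      exact hmem
  -- `T = (A₁)_Q` is a localisation of an algebra of finite type over `k`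
  have hA₁T : A₁.toSubring ≤ T := le_of_locChar hT'
  letI : Algebra A₁.toSubring T := (Subring.inclusion hA₁T).toAlgebra
  haveI : IsLocalization.AtPrime T Q := isLocalization_of_locChar hT' fun r => rfl
  haveI : Algebra.FiniteType k A₁ := (Subalgebra.fg_iff_finiteType A₁).mp hfg
  have hexc : IsExcellentRing A₁.toSubring := isExcellentRing_of_finiteType_field k A₁
  exact hexc.of_isLocalization Q.primeCompl

end Excellence

end GeoDict

end Summit.ResolutionOfSingularities.ResolutionOfSingularities.Theorems.SwitchingDichotomy

end
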